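import Literature.AlgebraicGeometry.ShimuraVarieties.UnitaryBallConeFormPullback
import HarnessLib

/-!
# The cone pull-back of a holomorphic 1-form of a compact ball quotient as a function on `GL_{p+1}(ℂ)`: left `Γ`-invariance,
# radial vanishing, homogeneity, and the cotangent `K`-type (any rank `p`; no ball∕frame model)

Topic `AlgebraicGeometry/ShimuraVarieties`; namespace `Literature.AlgebraicGeometry.ShimuraVarieties.UnitaryBallUniformisationDatum`
(datum-dotted).  THEOREMS ONLY (no definition, no named fact, no instance, no `sorry`).  Cell `hodgecm-mathlib`, FLOOR-0 P5, sub-line S1∕S1b,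
realisation letter S1-R, piece M1 of the by-name census (A-p14 (g14) `S1R-byname-census` §3): the `p = 1` COTANGENT COCYCLE OF THE CONE —
the one piece of the ball-chart dictionary ([Borel1997] §5.14: classical forms ↦ functions on the group, ★ `UnitaryBallClassMap.classPull`
for `p = 2`) that the CURVE needs, written chart-free on the negative cone so that no `𝔹¹`∕`U(1,1)` model is required.
HC_CM is proved only modulo the 7 printed citations until rung 0 closes; nothing printed is asserted here.

For `D : UnitaryBallUniformisationDatum p X`, `A : HodgeModel p X`, `ψ := (X^an ≃ X(ℂ))⁻¹ ∘ unif : ℂ^{p+1} → X^an` (holomorphic on the cone,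
★ `UnitaryBallConeFormPullback` §1), the CONE PULL-BACK FUNCTION of a `1`-form `α` of `X^an` with base vector `v₀` and direction `t₀` is
`F_α(g) := α_{ψ(g v₀)}(dψ_{g v₀}(g t₀))` for `g ∈ GL_{p+1}(ℂ)`.  We prove:
* §1 `symm_comp_unif_act` — `Γ` acts trivially through `unif`: `ψ(γ v) = ψ(v)` (field `unif_eq_unif_iff` at `c = 1`);
* §2 `mfderiv_symm_comp_unif_comp_linear` — the chain rule along an invertible-free LINEAR map `L` of `ℂ^{p+1}` with `ψ ∘ L = ψ` near `v`:
  `dψ_{Lv}(L t) = dψ_v(t)`; instances `mfderiv_symm_comp_unif_act` (`L = γ ∈ Γ`) and `mfderiv_symm_comp_unif_smul` (`L = c • 1`, `c ≠ 0`);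
* §3 `mfderiv_symm_comp_unif_self` — RADIAL VANISHING `dψ_v(v) = 0` (`c ↦ ψ(c v)` is constant near `1`);
* §4 the cotangent laws of `F_α`: `conePullbackFun_left_mul` (`F_α(γ g) = F_α(g)` for `γ ∈ Γ`) and `conePullbackFun_right_mul`
  (`F_α(g k) = (a c⁻¹) · F_α(g)` whenever `k v₀ = c v₀`, `k t₀ = a t₀ + b v₀` — at `p = 1` with `t₀ ⊥ v₀` this is the character of
  `K_∞ = Stab(ℂ v₀) = U(1) × U(1)` on the cotangent line of the disc, [Borel1997] §5.14's `μ(k, i)^{-2}` in unitary clothing).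

## References
* [Borel1997] A. Borel, *Automorphic forms on SL₂(ℝ)* (1997), §5.13–§5.14 (forms on the homogeneous space versus functions on the group).
* [BergeronMillsonMoeglin2016Balls] N. Bergeron, J. Millson, C. Moeglin, Acta Math. 216 (2016), Part 2 §§1.1–1.3 (the cone∕ball of negative lines).
* [VoisinHodgeI2002] C. Voisin, *Hodge Theory and Complex Algebraic Geometry I* (2002), §2.2.1 (holomorphic maps and their real differentials).
-/

set_option autoImplicit false

noncomputable section

open Matrix Function
open scoped Manifold Topology
open Literature.Geometry.Kaehler (MForm)
open Literature.NumberTheory.Transcendental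
open Literature.AlgebraicGeometry.HodgeTheory (HodgeModel)
open Literature.AlgebraicGeometry.Motives (SchemeOver ComplexPoints AlgPoints)

namespace Literature.AlgebraicGeometry.ShimuraVarieties

namespace UnitaryBallUniformisationDatum

variable {p : ℕ} {X : SchemeOver ℂ} (D : UnitaryBallUniformisationDatum p X) (A : HodgeModel p X)

/-! ### §1 `Γ` acts trivially through the uniformisation -/

/-- `ψ (γ v) = ψ v` for `γ ∈ Γ`, `ψ = (X^an ≃ X(ℂ))⁻¹ ∘ unif` (field `unif_eq_unif_iff` with `c = 1`; the `unif` form for the EXTENDED datum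
`UnitaryBallQuotientDatum` is ★ `UnitaryBallQuotientDatum.unif_act` of `HeckeCorrespondenceAction.lean` — here the bare uniformisation datum,
as carried by the pieces of the record curve). [cite: BergeronMillsonMoeglin2016Balls, Introduction §1.1] -/
theorem symm_comp_unif_act {γ : GL (Fin (p + 1)) D.E} (hγ : γ ∈ D.Γ) {v : Fin (p + 1) → ℂ} (hv : v ∈ D.cone) :
    (⇑A.isAnalytification.homeomorph.symm ∘ D.unif) (D.act γ v) = (⇑A.isAnalytification.homeomorph.symm ∘ D.unif) v := by
  have h : D.unif (D.act γ v) = D.unif v :=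
    ((D.unif_eq_unif_iff v hv (D.act γ v) (D.act_mem_cone hγ hv)).2 ⟨γ, hγ, 1, one_ne_zero, by rw [one_smul]⟩).symm
  simp only [Function.comp_apply, h]

/-! ### §2 The chain rule along a linear map preserving `ψ` near a cone point -/

/-- **Chain rule along a `ℂ`-linear map `L` with `ψ ∘ L = ψ` near `v`**: `dψ_{L v}(L t) = dψ_v(t)` (`v`, `L v` in the cone).
[cite: VoisinHodgeI2002, §2.2.1] -/
theorem mfderiv_symm_comp_unif_comp_linear (L : (Fin (p + 1) → ℂ) →ₗ[ℂ] (Fin (p + 1) → ℂ)) {v : Fin (p + 1) → ℂ}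
    (hLv : L v ∈ D.cone)
    (hL : ∀ᶠ y in 𝓝 v, (⇑A.isAnalytification.homeomorph.symm ∘ D.unif) (L y) = (⇑A.isAnalytification.homeomorph.symm ∘ D.unif) y)
    (t : Fin (p + 1) → ℂ) :
    mfderiv 𝓘(ℝ, Fin (p + 1) → ℂ) 𝓘(ℝ, A.model) (⇑A.isAnalytification.homeomorph.symm ∘ D.unif) (L v) (L t) =
      mfderiv 𝓘(ℝ, Fin (p + 1) → ℂ) 𝓘(ℝ, A.model) (⇑A.isAnalytification.homeomorph.symm ∘ D.unif) v t := by
  set ψ : (Fin (p + 1) → ℂ) → A.carrier := ⇑A.isAnalytification.homeomorph.symm ∘ D.unif with hψ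
  let Lℝ : (Fin (p + 1) → ℂ) →L[ℝ] (Fin (p + 1) → ℂ) := (LinearMap.toContinuousLinearMap L).restrictScalars ℝ
  have hLderiv : HasMFDerivAt 𝓘(ℝ, Fin (p + 1) → ℂ) 𝓘(ℝ, Fin (p + 1) → ℂ) (fun y ↦ L y) v Lℝ :=
    hasMFDerivAt_iff_hasFDerivAt.2 (((LinearMap.toContinuousLinearMap L).hasFDerivAt).restrictScalars ℝ)
  have hψd : HasMFDerivAt 𝓘(ℝ, Fin (p + 1) → ℂ) 𝓘(ℝ, A.model) ψ (L v)
      (mfderiv 𝓘(ℝ, Fin (p + 1) → ℂ) 𝓘(ℝ, A.model) ψ (L v)) :=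
    (D.mdifferentiableAt_symm_comp_unif_real A hLv).hasMFDerivAt
  have hcomp := (hψd.comp v hLderiv).mfderiv
  have hEq : (ψ ∘ fun y ↦ L y) =ᶠ[𝓝 v] ψ := hL
  have h1 : mfderiv 𝓘(ℝ, Fin (p + 1) → ℂ) 𝓘(ℝ, A.model) (ψ ∘ fun y ↦ L y) v t =
      mfderiv 𝓘(ℝ, Fin (p + 1) → ℂ) 𝓘(ℝ, A.model) ψ (L v) (Lℝ t) := by
    rw [hcomp]
    rfl
  have hLt : (L t : Fin (p + 1) → ℂ) = Lℝ t := rfl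
  rw [hLt, ← h1]
  exact congrFun (congrArg DFunLike.coe hEq.mfderiv_eq) t

/-- **Instance `L = γ ∈ Γ`**: `dψ_{γ v}(γ t) = dψ_v(t)` (`Γ` preserves the open cone and `ψ ∘ γ = ψ` on it).
[cite: BergeronMillsonMoeglin2016Balls, Part 2 §1.3] [cite: VoisinHodgeI2002, §2.2.1] -/
theorem mfderiv_symm_comp_unif_act {γ : GL (Fin (p + 1)) D.E} (hγ : γ ∈ D.Γ) {v : Fin (p + 1) → ℂ} (hv : v ∈ D.cone)
    (t : Fin (p + 1) → ℂ) :
    mfderiv 𝓘(ℝ, Fin (p + 1) → ℂ) 𝓘(ℝ, A.model) (⇑A.isAnalytification.homeomorph.symm ∘ D.unif) (D.act γ v) (D.act γ t) =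
      mfderiv 𝓘(ℝ, Fin (p + 1) → ℂ) 𝓘(ℝ, A.model) (⇑A.isAnalytification.homeomorph.symm ∘ D.unif) v t := by
  have hL : ∀ᶠ y in 𝓝 v, (⇑A.isAnalytification.homeomorph.symm ∘ D.unif)
      (Matrix.mulVecLin (((γ : Matrix (Fin (p + 1)) (Fin (p + 1)) D.E)).map D.τ₁) y) =
        (⇑A.isAnalytification.homeomorph.symm ∘ D.unif) y := by
    filter_upwards [(isOpen_negCone _).mem_nhds hv] with y hy
    exact D.symm_comp_unif_act A hγ hy
  exact D.mfderiv_symm_comp_unif_comp_linear A (Matrix.mulVecLin (((γ : Matrix (Fin (p + 1)) (Fin (p + 1)) D.E)).map D.τ₁))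
    (D.act_mem_cone hγ hv) hL t

/-- **Instance `L = c • 1`**, `c ≠ 0`: `dψ_{c v}(c t) = dψ_v(t)` (homogeneity: `ψ(c u) = ψ(u)`). [cite: BergeronMillsonMoeglin2016Balls, Part 2 §1.3]
[cite: VoisinHodgeI2002, §2.2.1] -/
theorem mfderiv_symm_comp_unif_smul {c : ℂ} (hc : c ≠ 0) {v : Fin (p + 1) → ℂ} (hv : v ∈ D.cone) (t : Fin (p + 1) → ℂ) :
    mfderiv 𝓘(ℝ, Fin (p + 1) → ℂ) 𝓘(ℝ, A.model) (⇑A.isAnalytification.homeomorph.symm ∘ D.unif) (c • v) (c • t) =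
      mfderiv 𝓘(ℝ, Fin (p + 1) → ℂ) 𝓘(ℝ, A.model) (⇑A.isAnalytification.homeomorph.symm ∘ D.unif) v t := by
  have hcid : ∀ y : Fin (p + 1) → ℂ, ((c • LinearMap.id : (Fin (p + 1) → ℂ) →ₗ[ℂ] (Fin (p + 1) → ℂ)) y) = c • y :=
    fun y ↦ rfl
  have hL : ∀ᶠ y in 𝓝 v, (⇑A.isAnalytification.homeomorph.symm ∘ D.unif)
      ((c • LinearMap.id : (Fin (p + 1) → ℂ) →ₗ[ℂ] (Fin (p + 1) → ℂ)) y) = (⇑A.isAnalytification.homeomorph.symm ∘ D.unif) y := by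
    filter_upwards [(isOpen_negCone _).mem_nhds hv] with y hy
    rw [hcid]
    exact D.symm_comp_unif_smul A hc hy
  have hLv : ((c • LinearMap.id : (Fin (p + 1) → ℂ) →ₗ[ℂ] (Fin (p + 1) → ℂ)) v) ∈ D.cone := by
    rw [hcid]
    exact smul_mem_negCone hc hv
  have h := D.mfderiv_symm_comp_unif_comp_linear A (c • LinearMap.id) hLv hL t
  rw [hcid, hcid] at h
  exact h

/-! ### §3 Radial vanishing -/

/-- **`dψ_v(v) = 0`** on the cone: `c ↦ ψ(c • v)` is constant near `c = 1` (`ψ` factors through the ball of negative LINES), so its derivative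
at `1` — which is `dψ_v(v)` by the chain rule — vanishes. [cite: BergeronMillsonMoeglin2016Balls, Part 2 §1.3] [cite: VoisinHodgeI2002, §2.2.1] -/
theorem mfderiv_symm_comp_unif_self {v : Fin (p + 1) → ℂ} (hv : v ∈ D.cone) :
    mfderiv 𝓘(ℝ, Fin (p + 1) → ℂ) 𝓘(ℝ, A.model) (⇑A.isAnalytification.homeomorph.symm ∘ D.unif) v v = 0 := by
  set ψ : (Fin (p + 1) → ℂ) → A.carrier := ⇑A.isAnalytification.homeomorph.symm ∘ D.unif with hψ
  -- the line `c ↦ c • v` through `v` at `c = 1`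
  let ℓ : ℂ →L[ℝ] (Fin (p + 1) → ℂ) := ((LinearMap.id : ℂ →ₗ[ℂ] ℂ).smulRight v).toContinuousLinearMap.restrictScalars ℝ
  have hℓ : ∀ c : ℂ, (fun c : ℂ ↦ c • v) c = ℓ c := fun c ↦ rfl
  have hℓderiv : HasMFDerivAt 𝓘(ℝ, ℂ) 𝓘(ℝ, Fin (p + 1) → ℂ) (fun c : ℂ ↦ c • v) 1 ℓ :=
    hasMFDerivAt_iff_hasFDerivAt.2
      ((((LinearMap.id : ℂ →ₗ[ℂ] ℂ).smulRight v).toContinuousLinearMap.hasFDerivAt).restrictScalars ℝ)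
  have h1v : (fun c : ℂ ↦ c • v) 1 = v := one_smul ℂ v
  have hψd : HasMFDerivAt 𝓘(ℝ, Fin (p + 1) → ℂ) 𝓘(ℝ, A.model) ψ ((fun c : ℂ ↦ c • v) 1)
      (mfderiv 𝓘(ℝ, Fin (p + 1) → ℂ) 𝓘(ℝ, A.model) ψ v) := by
    rw [h1v]
    exact (D.mdifferentiableAt_symm_comp_unif_real A hv).hasMFDerivAt
  have hcomp := (hψd.comp 1 hℓderiv).mfderiv
  -- the composite is constant near `1`
  have hEq : (ψ ∘ fun c : ℂ ↦ c • v) =ᶠ[𝓝 (1 : ℂ)] fun _ ↦ ψ v := by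
    filter_upwards [isOpen_ne.mem_nhds one_ne_zero] with c hc
    exact D.symm_comp_unif_smul A hc hv
  have hconst : mfderiv 𝓘(ℝ, ℂ) 𝓘(ℝ, A.model) (ψ ∘ fun c : ℂ ↦ c • v) 1 = 0 :=
    hEq.mfderiv_eq.trans mfderiv_const
  have happ := congrArg (fun f ↦ f (1 : ℂ)) hcomp
  rw [hconst] at happ
  have hℓ1 : ℓ 1 = v := by
    change ((1 : ℂ) • v : Fin (p + 1) → ℂ) = v
    exact one_smul ℂ v
  calc mfderiv 𝓘(ℝ, Fin (p + 1) → ℂ) 𝓘(ℝ, A.model) ψ v v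
      = mfderiv 𝓘(ℝ, Fin (p + 1) → ℂ) 𝓘(ℝ, A.model) ψ v (ℓ 1) := congrArg _ hℓ1.symm
    _ = ((mfderiv 𝓘(ℝ, Fin (p + 1) → ℂ) 𝓘(ℝ, A.model) ψ v).comp ℓ) (1 : ℂ) := rfl
    _ = (0 : ℂ →L[ℝ] TangentSpace 𝓘(ℝ, A.model) (ψ v)) (1 : ℂ) := happ.symm
    _ = 0 := rfl

/-! ### §4 The cone pull-back function on `GL_{p+1}(ℂ)` and its cotangent laws -/

/-- **Left `Γ`-invariance**: for `γ ∈ Γ` (acting on `ℂ^{p+1}` through `τ₁`) and `g` with `g v₀` in the cone,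
`α_{ψ(γ g v₀)}(dψ_{γ g v₀}(γ g t₀)) = α_{ψ(g v₀)}(dψ_{g v₀}(g t₀))`. [cite: Borel1997, §5.13–§5.14] -/
theorem conePullback_act (α : MForm 𝓘(ℝ, A.model) A.carrier ℂ 1) {γ : GL (Fin (p + 1)) D.E} (hγ : γ ∈ D.Γ)
    {u : Fin (p + 1) → ℂ} (hu : u ∈ D.cone) (t : Fin (p + 1) → ℂ) :
    α ((⇑A.isAnalytification.homeomorph.symm ∘ D.unif) (D.act γ u))
        (fun _ ↦ mfderiv 𝓘(ℝ, Fin (p + 1) → ℂ) 𝓘(ℝ, A.model) (⇑A.isAnalytification.homeomorph.symm ∘ D.unif) (D.act γ u) (D.act γ t)) =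
      α ((⇑A.isAnalytification.homeomorph.symm ∘ D.unif) u)
        (fun _ ↦ mfderiv 𝓘(ℝ, Fin (p + 1) → ℂ) 𝓘(ℝ, A.model) (⇑A.isAnalytification.homeomorph.symm ∘ D.unif) u t) := by
  rw [D.symm_comp_unif_act A hγ hu]
  congr 2
  funext
  exact D.mfderiv_symm_comp_unif_act A hγ hu t

/-- **The cotangent `K`-type** (any `p`): if `k u = c • u` (`c ≠ 0`) and `k t = a • t + b • u` then
`α_{ψ(k u)}(dψ_{k u}(k t)) = (a c⁻¹) · α_{ψ u}(dψ_u t)` for a `ℂ`-LINEAR form `α` (homogeneity `dψ_{cu}(c s) = dψ_u(s)`, radial vanishing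
`dψ_u(u) = 0`). At `p = 1` with `t ⊥ u` this is the character of `K_∞ = Stab(ℂ u) ≅ U(1) × U(1)` on the cotangent line of the disc at `[u]`.
[cite: Borel1997, §5.13–§5.14] [cite: VoisinHodgeI2002, §2.2.1] -/
theorem conePullback_of_smul_eq {α : MForm 𝓘(ℝ, A.model) A.carrier ℂ 1} (hα : IsComplexLinearForm α)
    {u t ku kt : Fin (p + 1) → ℂ} (hu : u ∈ D.cone) {a b c : ℂ} (hc : c ≠ 0) (hku : ku = c • u) (hkt : kt = a • t + b • u) :
    α ((⇑A.isAnalytification.homeomorph.symm ∘ D.unif) ku)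
        (fun _ ↦ mfderiv 𝓘(ℝ, Fin (p + 1) → ℂ) 𝓘(ℝ, A.model) (⇑A.isAnalytification.homeomorph.symm ∘ D.unif) ku kt) =
      (a * c⁻¹) * α ((⇑A.isAnalytification.homeomorph.symm ∘ D.unif) u)
        (fun _ ↦ mfderiv 𝓘(ℝ, Fin (p + 1) → ℂ) 𝓘(ℝ, A.model) (⇑A.isAnalytification.homeomorph.symm ∘ D.unif) u t) := by
  subst hku hkt
  have hcu : c • u ∈ D.cone := smul_mem_negCone hc hu
  -- rewrite the direction as `c • (a c⁻¹ • t + b c⁻¹ • u)` and use homogeneity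
  have hdir : a • t + b • u = c • ((a * c⁻¹) • t + (b * c⁻¹) • u) := by
    rw [smul_add, smul_smul, smul_smul, mul_comm c, mul_assoc, inv_mul_cancel₀ hc, mul_one, mul_comm c, mul_assoc,
      inv_mul_cancel₀ hc, mul_one]
  rw [hdir, D.mfderiv_symm_comp_unif_smul A hc hu, D.symm_comp_unif_smul A hc hu,
    D.mform_apply_mfderiv_symm_comp_unif_add A α u, D.mform_apply_mfderiv_symm_comp_unif_smul A hα hu,
    D.mform_apply_mfderiv_symm_comp_unif_smul A hα hu, D.mfderiv_symm_comp_unif_self A hu]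
  have h0 : α ((⇑A.isAnalytification.homeomorph.symm ∘ D.unif) u) (fun _ ↦ (0 : TangentSpace 𝓘(ℝ, A.model) _)) = 0 :=
    (α ((⇑A.isAnalytification.homeomorph.symm ∘ D.unif) u)).map_zero
  rw [h0, mul_zero, add_zero]

end UnitaryBallUniformisationDatum

end Literature.AlgebraicGeometry.ShimuraVarieties

end
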